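import Summits.QuantumFields.YangMills.Theorems.BalabanUVNodesN15FullPropagatorExactUnitSocket

/-!
# Route «BalabanUVNodes», cluster K4 «SpineRates» — node N15 = NE2, file V-G (dag-n15-a g17, programme V): THE SOCKET's INPUT REDUCED TO THE OPERATOR LAYER's OWN LETTERS —
# the three bond letters of `Z = Q W Q*` from three block majorants of the increment `W(U) = E(U) − G` (size, two-grid defect, η-gradient), generic in `W`; hence `NE2PlusUnit` ∕
# `N15At` with the exactly dressed U-seeing unit layer from increment letters alone

Cell `pub-ymgap`, seat `pub-ymgap-dag-n15-a` (-a KNIT-BY-NAME seat of node N15; HUMAN RULING D-0062; chair R424 venue), generation 17, file V-G of programme V (INBOX «DAGN15A-G17-INTENT-6»).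
`bears_on: R4∕N15 · K3⁷ SpineGivenEndpointR13SepCoPH (stmt-QuantumFields-20544)`.  Filed `--kind proof --supports stmt-QuantumFields-20544 --as helper` — COUNT-NEUTRAL.  THEOREMS ONLY
(0 `def`, 0 `sorry`).  Imports V-F (through it V-A…V-D, U-C…U-C3, parts 37∕45); nothing in the tree is modified.  §1 is U-C's §2–§3 (`hasMaj_zOp`, `zOp_sub_eq`, `hasMaj_zOp_sub`,
`hasMaj_grad_wOp_qvAdj`'s last step) with the species' increment `wOp` replaced by an ARBITRARY fine-lattice operator `W`.
WHAT.  §1 ★ `hasMaj_qWq` (`W ≤ β_We^{−ρd}` on King blocks ⟹ `QWQ* ≤ (β_We^{ρ}c_r(σ)e^{ρ−σ})e^{−(ρ−σ)d}`), `qWq_sub_eq` (three-term split `Q′W′Q′* − QWQ* = Q′W′(Q′* − PQ*) + Q′·𝔇^P(W′,W)·Q* +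
(Q′P − Q)WQ*`), ★ `hasMaj_grad_qvAdj_of_grad` (gradient letter of `W∘Q*` with the gain `(L^k)⁻¹`), ★★ `hasMaj_qWq_sub`.  §2 ★★★ **`zLetters_of_incrementLetters`**: for fine-run increments
`Wf i U` (fineness `L^mL^k`) and coarse-run increments `Wc i V` (fineness `L^k`) with UNIFORM letters (L1) `Wc i (avg U)`, `Wf i U ≤ β_Wα₀e^{−ρd}`, (L2) `𝔇^P(Wf i U, Wc i (avg U)) ≤ m_Wθ_Z^ke^{−ρd}`,
(L3) `ρ(sD_κ)∘Wc i (avg U) ≤ β_Dα₀e^{−ρd}` (`0 < α₀ ≤ a₁`, `Reg335 c₃₅ α₀ U`), the socket's three bond letters for `Zf = unitBondMat (Q′WfQ′*)`, `Zc = unitBondMat (QWcQ*)`.  §3 ★★★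
**`ne2PlusUnit_tgCovExOn_of_incrementLetters`**, ★★★ **`n15At_tgEx_of_incrementLetters`** — V-F ∘ §2: the exactly dressed U-seeing (2.156) unit layer and `N15At` for ANY family
`⟨tgGeoC (ι i), gf i, Bc i, Bf i, pair i⟩` from an operator layer BY NAME plus the three increment letters (every producer's en-route lemmas: size of `E(U) − G`, its two-grid defect
= entry 0 of `E` minus part 52's of `G` (`idef_sub_sub`), its η-gradient = entry 1).
HONEST FRAMING.  Count-neutral socket algebra over landed block-majorant lemmas (parts 37∕45, U-C, B11SectG); the increment letters are HYPOTHESES here (for dag-n15-c's primitive-carrier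
species they are U-C∕U-C2's theorems — that instance is V-D); MODEL-LEVEL wherever instantiated by a model species; `Q` abelianised, `Sym` in the bond basis.  NOT [B9] Thm 3.15 at a
general (3.35)-regular `U`; N15 NOT discharged (typed 28∕28 · discharged 5∕27 of record unchanged); nothing continuum ∕ ℝ⁴ ∕ OS ∕ mass-gap ∕ Clay.  Restate-immune (no Theses import).
-/

set_option autoImplicit false

noncomputable section

open scoped BigOperators
open Finset
namespace Summit.QuantumFields.YangMills.BalabanUVNodes.N15.UnitLayerBg

open Literature.MathematicalPhysics.QuantumFieldTheory.Balaban1983to89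
open Literature.MathematicalPhysics.QuantumFieldTheory.Balaban1983to89.B11SectG (BlockNorm HasMaj RowSum hasMaj_comp_exp)
open Literature.MathematicalPhysics.QuantumFieldTheory.Balaban1983to89.T4EtaRate (PairedInstance EtaPairing NE2PlusOperator NE2PlusUnit)
open Literature.MathematicalPhysics.QuantumFieldTheory.Balaban1983to89.T4EtaRateDefect (idef)
open Literature.MathematicalPhysics.QuantumFieldTheory.Balaban1983to89.T4EtaRateCoeffDefect (pull)
open Literature.MathematicalPhysics.QuantumFieldTheory.Balaban1983to89.B5Prop11Plancherel (Tor fine)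
open Literature.MathematicalPhysics.QuantumFieldTheory.Balaban1983to89.B6Lemma24Torus (pbox)
open Literature.MathematicalPhysics.QuantumFieldTheory.Balaban1983to89.B6BondEliminationTorus (pdist)
open Literature.MathematicalPhysics.QuantumFieldTheory.Balaban1983to89.B6Cov2156Torus (one_le_M)
open Literature.MathematicalPhysics.QuantumFieldTheory.Balaban1983to89.B6UnitTorusCarrier (unitTorusGeo triangle254_unitTorusGeo rowSum_unitTorusGeo unitTorusGeo_dist_nonneg
  unitTorusGeo_dist_self)
open Literature.MathematicalPhysics.QuantumFieldTheory.Balaban1983to89.B4Sect5Proof (latticeConst latticeConst_nonneg)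
open Literature.MathematicalPhysics.QuantumFieldTheory.Balaban1983to89.B9Eq3130MatrixLetters (hasMaj_id_ofBlocks)
open Literature.MathematicalPhysics.QuantumFieldTheory.King1986 (exp_decay_mono)
open Literature.MathematicalPhysics.QuantumFieldTheory.King1986.Torus (blockOf tdistT tdistT_nonneg)
open Summit.QuantumFields.YangMills.BalabanUVNodes.N15.TwoGrid (symbOp sD qvRe qvAdjRe TGIndex tgGeoC hasMaj_qvRe_comp hasMaj_qvAdjRe_sub_pull_comp hasMaj_qvRe_pull_sub_comp
  hasMaj_smul_ofBlocks)
open Summit.QuantumFields.YangMills.BalabanUVNodes.N15.VectorPiece (blkFine kingPrV)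
open Summit.QuantumFields.YangMills.BalabanUVNodes.N15.BackgroundModel (kappa_ofBlocks)
open Summit.QuantumFields.YangMills.BalabanUVNodes.N15.GenuineRecord (tgSiteOn)
open YMDAG.UVSplit (N15At)
variable {d : ℕ} {L : ℕ} [NeZero L]

/-! ## §1 The middle factor `Q W Q*` of an arbitrary increment: size, three-term split, gradient letter, η-difference -/

section Generic
variable {M : Fin (d + 1) → ℕ} [∀ μ, NeZero (M μ)] (k : ℕ) {n : ℕ} [NeZero n] {σ ρ : ℝ}
omit [NeZero L] in
/-- ★ **THE MIDDLE FACTOR's BLOCK MAJORANT, GENERIC IN THE INCREMENT** (U-C `hasMaj_zOp` with `wOp ↦ W`): `W ≤ β_W·e^{−ρd}` on King's blocks (`0 < σ ≤ ρ`) ⟹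
`Q_nWQ_n* ≤ (e^{ρ−σ}·β_W·e^{ρ}·c_r(σ))·e^{−(ρ−σ)d}` on unit 1-forms blocked by site. [cite: Balaban1984PropagatorsI, (1.18) p.20; Balaban1984PropagatorsII, (2.52)–(2.56) pp.232–233] -/
theorem hasMaj_qWq {W : (Tor (fine n M) × Fin (d + 1) → ℝ) →ₗ[ℝ] (Tor (fine n M) × Fin (d + 1) → ℝ)} {βW : ℝ} (hβW : 0 ≤ βW) (hσ : 0 < σ) (hσρ : σ ≤ ρ)
    (hW : HasMaj (BlockNorm.ofBlocks (unitTorusGeo L k M) (fun i : Tor (fine n M) × Fin (d + 1) => blockOf n M i.1))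
      (BlockNorm.ofBlocks (unitTorusGeo L k M) (fun i : Tor (fine n M) × Fin (d + 1) => blockOf n M i.1)) W (fun y y' => βW * Real.exp (-(ρ * tdistT M y y')))) :
    HasMaj (BlockNorm.ofBlocks (unitTorusGeo L k M) (fun bb : Tor M × Fin (d + 1) => bb.1)) (BlockNorm.ofBlocks (unitTorusGeo L k M) (fun bb : Tor M × Fin (d + 1) => bb.1))
      (qvRe M n ∘ₗ (W ∘ₗ qvAdjRe M n))
      (fun y y' => 1 * βW * (1 * Real.exp ρ) * latticeConst (d + 1) σ * Real.exp (ρ - σ) * Real.exp (-((ρ - σ) * tdistT M y y'))) := by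
  have htri := triangle254_unitTorusGeo (L := L) (k := k) (M := M)
  have hd := unitTorusGeo_dist_nonneg (L := L) (k := k) (M := M)
  have hrow := rowSum_unitTorusGeo (L := L) (k := k) (M := M) hσ
  have hρ : 0 ≤ ρ := hσ.le.trans hσρ
  have hQ := hasMaj_qvAdjRe (L := L) (M := M) (k := k) (n := n) hρ
  have hWQ := hasMaj_comp_exp htri hd hrow hβW (by positivity) (ρ := ρ - σ) (by linarith) (by linarith) (by linarith) hW hQ
  exact hasMaj_qvRe_comp M k n (B := 1 * βW * (1 * Real.exp ρ) * latticeConst (d + 1) σ) (ρ := ρ - σ)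
    (by have := latticeConst_nonneg (d + 1) hσ.le; positivity) (by linarith) (hWQ.mono fun y y' => le_of_eq (by rw [kappa_ofBlocks]))
variable (m : ℕ)
omit [NeZero n] in
/-- **THE THREE-TERM SPLIT, GENERIC** (U-C `zOp_sub_eq`): `Q′W′Q′* − QWQ* = Q′W′(Q′* − PQ*) + Q′·𝔇^P(W′, W)·Q* + (Q′P − Q)WQ*` (`P = pull kingPrV` King's prolongation).
[cite: King1986, p.664 (the pairing; shape)] [folklore] -/
theorem qWq_sub_eq (W' : (Tor (fine (L ^ m * L ^ k) M) × Fin (d + 1) → ℝ) →ₗ[ℝ] (Tor (fine (L ^ m * L ^ k) M) × Fin (d + 1) → ℝ))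
    (W : (Tor (fine (L ^ k) M) × Fin (d + 1) → ℝ) →ₗ[ℝ] (Tor (fine (L ^ k) M) × Fin (d + 1) → ℝ)) :
    qvRe M (L ^ m * L ^ k) ∘ₗ (W' ∘ₗ qvAdjRe M (L ^ m * L ^ k)) - qvRe M (L ^ k) ∘ₗ (W ∘ₗ qvAdjRe M (L ^ k)) =
      qvRe M (L ^ m * L ^ k) ∘ₗ (W' ∘ₗ ((qvAdjRe M (L ^ m * L ^ k) - pull (kingPrV L k m M) ∘ₗ qvAdjRe M (L ^ k)) ∘ₗ LinearMap.id))
      + qvRe M (L ^ m * L ^ k) ∘ₗ (idef (pull (kingPrV L k m M)) (pull (kingPrV L k m M)) W' W ∘ₗ qvAdjRe M (L ^ k))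
      + (qvRe M (L ^ m * L ^ k) ∘ₗ pull (kingPrV L k m M) - qvRe M (L ^ k)) ∘ₗ (W ∘ₗ qvAdjRe M (L ^ k)) := by
  unfold idef
  simp only [LinearMap.comp_id, LinearMap.comp_sub, LinearMap.sub_comp, LinearMap.comp_assoc]
  abel
omit [NeZero n] in
/-- ★ **THE GRADIENT LETTER OF `W∘Q*` FROM AN η-GRADIENT MAJORANT OF `W`** (U-C `hasMaj_grad_wOp_qvAdj`'s last step, generic): `ρ(sD_κ(L^k))∘W ≤ β_D·e^{−ρd}` (King blocks)
⟹ `((L^k)⁻¹•ρ(sD_κ))∘W∘Q* ≤ (L^k)⁻¹·(β_D·e^{ρ}·c_r(σ))·e^{−(ρ−σ)d}` from unit 1-forms by site into King blocks — the gain `(L^k)⁻¹ = η`. [cite: Balaban1984PropagatorsI, (1.18) p.20; (1.110) p.35 (shape)] -/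
theorem hasMaj_grad_qvAdj_of_grad {W : (Tor (fine (L ^ k) M) × Fin (d + 1) → ℝ) →ₗ[ℝ] (Tor (fine (L ^ k) M) × Fin (d + 1) → ℝ)} {βD : ℝ} (hβD : 0 ≤ βD) (hσ : 0 < σ) (hσρ : σ ≤ ρ)
    (κ : Fin (d + 1))
    (hD : HasMaj (BlockNorm.ofBlocks (unitTorusGeo L k M) (blkFine L k M)) (BlockNorm.ofBlocks (unitTorusGeo L k M) (blkFine L k M))
      (symbOp M (L ^ k) (sD M (L ^ k) κ ((L ^ k : ℕ) : ℝ)) ∘ₗ W) (fun y y' => βD * Real.exp (-(ρ * tdistT M y y')))) :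
    HasMaj (BlockNorm.ofBlocks (unitTorusGeo L k M) (fun bb : Tor M × Fin (d + 1) => bb.1)) (BlockNorm.ofBlocks (unitTorusGeo L k M) (blkFine L k M))
      ((((L ^ k : ℕ) : ℝ)⁻¹ • symbOp M (L ^ k) (sD M (L ^ k) κ ((L ^ k : ℕ) : ℝ))) ∘ₗ (W ∘ₗ qvAdjRe M (L ^ k)))
      (fun y y' => ((L ^ k : ℕ) : ℝ)⁻¹ * (1 * βD * (1 * Real.exp ρ) * latticeConst (d + 1) σ) * Real.exp (-((ρ - σ) * tdistT M y y'))) := by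
  have htri := triangle254_unitTorusGeo (L := L) (k := k) (M := M)
  have hd := unitTorusGeo_dist_nonneg (L := L) (k := k) (M := M)
  have hrow := rowSum_unitTorusGeo (L := L) (k := k) (M := M) hσ
  have hρ : 0 ≤ ρ := hσ.le.trans hσρ
  have hK0 := latticeConst_nonneg (d + 1) hσ.le
  have hQ : HasMaj (BlockNorm.ofBlocks (unitTorusGeo L k M) (fun bb : Tor M × Fin (d + 1) => bb.1)) (BlockNorm.ofBlocks (unitTorusGeo L k M) (blkFine L k M))
      (qvAdjRe M (L ^ k)) (fun y y' => 1 * Real.exp ρ * Real.exp (-(ρ * tdistT M y y'))) := hasMaj_qvAdjRe (L := L) (M := M) (k := k) (n := L ^ k) hρ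
  have hDQ := hasMaj_comp_exp htri hd hrow hβD (by positivity) (ρ := ρ - σ) (by linarith) (by linarith) (by linarith) hD hQ
  have e : (((L ^ k : ℕ) : ℝ)⁻¹ • symbOp M (L ^ k) (sD M (L ^ k) κ ((L ^ k : ℕ) : ℝ))) ∘ₗ (W ∘ₗ qvAdjRe M (L ^ k)) =
      ((L ^ k : ℕ) : ℝ)⁻¹ • ((symbOp M (L ^ k) (sD M (L ^ k) κ ((L ^ k : ℕ) : ℝ)) ∘ₗ W) ∘ₗ qvAdjRe M (L ^ k)) := by
    rw [LinearMap.smul_comp]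
    simp only [LinearMap.comp_assoc]
  rw [e]
  refine (hasMaj_smul_ofBlocks (g := unitTorusGeo L k M) (blkFine L k M) (fun y y' => ?_) (((L ^ k : ℕ) : ℝ)⁻¹) hDQ).mono fun y y' => le_of_eq ?_
  · simp only [kappa_ofBlocks]; positivity
  · have h0 : (0 : ℝ) ≤ (((L ^ k : ℕ) : ℝ))⁻¹ := by positivity
    simp only [kappa_ofBlocks, abs_of_nonneg h0]
    ring
omit [NeZero n] in
/-- ★★ **THE η-DIFFERENCE OF THE MIDDLE FACTOR, GENERIC IN THE INCREMENT** (U-C `hasMaj_zOp_sub` with `wOp ↦ W, W′`): from `W′ ≤ β_We^{−ρd}`, `𝔇^P(W′, W) ≤ m_We^{−ρd}` and the gradient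
letter `(L^k)⁻¹ρ(sD_κ)∘W∘Q* ≤ β_D′e^{−ρd}` (`0 < σ`, `2σ ≤ ρ`): `Q′W′Q′* − QWQ* ≤ [2e^{ρ}∕L^k·β_Wc_re^{ρ−σ} + m_We^{ρ}c_re^{ρ−σ} + β_D′e^{ρ}]e^{−(ρ−σ)d}`. [cite: King1986, Lemma 4.5 (4.38) p.674 (shape)] -/
theorem hasMaj_qWq_sub {W' : (Tor (fine (L ^ m * L ^ k) M) × Fin (d + 1) → ℝ) →ₗ[ℝ] (Tor (fine (L ^ m * L ^ k) M) × Fin (d + 1) → ℝ)}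
    {W : (Tor (fine (L ^ k) M) × Fin (d + 1) → ℝ) →ₗ[ℝ] (Tor (fine (L ^ k) M) × Fin (d + 1) → ℝ)} {βW mW βD σ ρ : ℝ} (hβW : 0 ≤ βW) (hmW : 0 ≤ mW) (hβD : 0 ≤ βD)
    (hσ : 0 < σ) (hσρ : 2 * σ ≤ ρ)
    (hW' : HasMaj (BlockNorm.ofBlocks (unitTorusGeo L k M) (fun i : Tor (fine (L ^ m * L ^ k) M) × Fin (d + 1) => blockOf (L ^ m * L ^ k) M i.1))
      (BlockNorm.ofBlocks (unitTorusGeo L k M) (fun i : Tor (fine (L ^ m * L ^ k) M) × Fin (d + 1) => blockOf (L ^ m * L ^ k) M i.1)) W'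
      (fun y y' => βW * Real.exp (-(ρ * tdistT M y y'))))
    (hE : HasMaj (BlockNorm.ofBlocks (unitTorusGeo L k M) (blkFine L k M))
      (BlockNorm.ofBlocks (unitTorusGeo L k M) (fun i : Tor (fine (L ^ m * L ^ k) M) × Fin (d + 1) => blockOf (L ^ m * L ^ k) M i.1))
      (idef (pull (kingPrV L k m M)) (pull (kingPrV L k m M)) W' W) (fun y y' => mW * Real.exp (-(ρ * tdistT M y y'))))
    (hDW : ∀ κ : Fin (d + 1), HasMaj (BlockNorm.ofBlocks (unitTorusGeo L k M) (fun bb : Tor M × Fin (d + 1) => bb.1)) (BlockNorm.ofBlocks (unitTorusGeo L k M) (blkFine L k M))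
      ((((L ^ k : ℕ) : ℝ)⁻¹ • symbOp M (L ^ k) (sD M (L ^ k) κ ((L ^ k : ℕ) : ℝ))) ∘ₗ (W ∘ₗ qvAdjRe M (L ^ k))) (fun y y' => βD * Real.exp (-(ρ * tdistT M y y')))) :
    HasMaj (BlockNorm.ofBlocks (unitTorusGeo L k M) (fun bb : Tor M × Fin (d + 1) => bb.1)) (BlockNorm.ofBlocks (unitTorusGeo L k M) (fun bb : Tor M × Fin (d + 1) => bb.1))
      (qvRe M (L ^ m * L ^ k) ∘ₗ (W' ∘ₗ qvAdjRe M (L ^ m * L ^ k)) - qvRe M (L ^ k) ∘ₗ (W ∘ₗ qvAdjRe M (L ^ k)))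
      (fun y y' => (1 * βW * (2 * Real.exp ρ / (L : ℝ) ^ k * 1) * latticeConst (d + 1) σ * Real.exp (ρ - σ)
          + 1 * mW * (1 * Real.exp ρ) * latticeConst (d + 1) σ * Real.exp (ρ - σ) + βD * Real.exp ρ) * Real.exp (-((ρ - σ) * tdistT M y y'))) := by
  have htri := triangle254_unitTorusGeo (L := L) (k := k) (M := M)
  have hd := unitTorusGeo_dist_nonneg (L := L) (k := k) (M := M)
  have hrow := rowSum_unitTorusGeo (L := L) (k := k) (M := M) hσ
  have hρ : 0 ≤ ρ := by linarith
  have hK0 := latticeConst_nonneg (d + 1) hσ.le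
  have hL0 : (0 : ℝ) < L := by exact_mod_cast Nat.pos_of_ne_zero (NeZero.ne L)
  have hid := hasMaj_id_ofBlocks (g := unitTorusGeo L k M) (fun bb : Tor M × Fin (d + 1) => bb.1) (unitTorusGeo_dist_self (L := L) (k := k) (M := M)) ρ
  -- T1 = Q′∘(W′∘((Q′* − PQ*)∘id))
  have h1a := hasMaj_qvAdjRe_sub_pull_comp M k m (B := 1) (ρ := ρ) zero_le_one hρ hid
  have h1b := hasMaj_comp_exp htri hd hrow hβW (by positivity) (ρ := ρ - σ) (by linarith) (by linarith) (by linarith) hW' h1a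
  have h1 := hasMaj_qvRe_comp M k (L ^ m * L ^ k) (B := 1 * βW * (2 * Real.exp ρ / (L : ℝ) ^ k * 1) * latticeConst (d + 1) σ) (ρ := ρ - σ)
    (by positivity) (by linarith) (h1b.mono fun y y' => le_of_eq (by rw [kappa_ofBlocks]))
  -- T2 = Q′∘(𝔇(W′,W)∘Q*)
  have h2a : HasMaj (BlockNorm.ofBlocks (unitTorusGeo L k M) (fun bb : Tor M × Fin (d + 1) => bb.1)) (BlockNorm.ofBlocks (unitTorusGeo L k M) (blkFine L k M))
      (qvAdjRe M (L ^ k)) (fun y y' => 1 * Real.exp ρ * Real.exp (-(ρ * tdistT M y y'))) := hasMaj_qvAdjRe (L := L) (M := M) (k := k) (n := L ^ k) hρ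
  have h2b := hasMaj_comp_exp htri hd hrow hmW (by positivity) (ρ := ρ - σ) (by linarith) (by linarith) (by linarith) hE h2a
  have h2 := hasMaj_qvRe_comp M k (L ^ m * L ^ k) (B := 1 * mW * (1 * Real.exp ρ) * latticeConst (d + 1) σ) (ρ := ρ - σ)
    (by positivity) (by linarith) (h2b.mono fun y y' => le_of_eq (by rw [kappa_ofBlocks]))
  -- T3 = (Q′P − Q)∘(W∘Q*)
  have h3 := hasMaj_qvRe_pull_sub_comp M k m (B := βD) (ρ := ρ) hβD hρ hDW
  rw [qWq_sub_eq (M := M) k m]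
  refine ((h1.add h2).add h3).mono fun y y' => ?_
  have hdy := tdistT_nonneg M y y'
  have hexp : Real.exp (-(ρ * tdistT M y y')) ≤ Real.exp (-((ρ - σ) * tdistT M y y')) := Real.exp_le_exp.mpr (by nlinarith)
  have hT3 : βD * Real.exp ρ * Real.exp (-(ρ * tdistT M y y')) ≤ βD * Real.exp ρ * Real.exp (-((ρ - σ) * tdistT M y y')) :=
    mul_le_mul_of_nonneg_left hexp (by positivity)
  have e : (1 * βW * (2 * Real.exp ρ / (L : ℝ) ^ k * 1) * latticeConst (d + 1) σ * Real.exp (ρ - σ)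
          + 1 * mW * (1 * Real.exp ρ) * latticeConst (d + 1) σ * Real.exp (ρ - σ) + βD * Real.exp ρ) * Real.exp (-((ρ - σ) * tdistT M y y'))
      = 1 * βW * (2 * Real.exp ρ / (L : ℝ) ^ k * 1) * latticeConst (d + 1) σ * Real.exp (ρ - σ) * Real.exp (-((ρ - σ) * tdistT M y y'))
        + 1 * mW * (1 * Real.exp ρ) * latticeConst (d + 1) σ * Real.exp (ρ - σ) * Real.exp (-((ρ - σ) * tdistT M y y'))
        + βD * Real.exp ρ * Real.exp (-((ρ - σ) * tdistT M y y')) := by ring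
  rw [e]
  exact add_le_add le_rfl hT3

end Generic

/-! ## §2 ★★★ The three bond letters of the middle factor from the three increment letters, uniform over a family -/

section Family
variable {I : Type} (ι : I → TGIndex) (gf : I → B9.Geometry) (Bc Bf : I → B9.Backgrounds)
/-- ★★★ **THE SOCKET's `Z`-LETTERS FROM INCREMENT LETTERS** (`L ≥ 2`, any `c₃₅`, rate `L⁻¹ ≤ θ_Z`): UNIFORM increment letters `∃ β_W m_W β_D ρ a₁ > 0 ∀ i, 0 < α₀ ≤ a₁, U` regular:
(L1) `Wc i (avg U)`, `Wf i U ≤ β_Wα₀e^{−ρd}` (King blocks), (L2) `𝔇^P(Wf i U, Wc i (avg U)) ≤ m_Wθ_Z^ke^{−ρd}`, (L3) `ρ(sD_κ(L^k))∘Wc i (avg U) ≤ β_Dα₀e^{−ρd}` ⟹ the three bond letters of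
`Zf = unitBondMat (Q′WfQ′*)`, `Zc = unitBondMat (QWcQ*)` (`δ_Z = ρ∕4`; `ζ, τ` after `(d, β_W, m_W, β_D, ρ, a₁)`). [cite: Balaban1984PropagatorsI, (1.18) p.20, (1.65)–(1.66) p.29 (objects); King1986, Lemma 4.5 (4.38) p.674 (shape)] -/
theorem zLetters_of_incrementLetters (hL2 : 2 ≤ L) (hL : Odd L ∧ 1 < L) (c35 : ℝ) (pair : ∀ i, EtaPairing (tgGeoC d hL (ι i)) (gf i) (Bc i) (Bf i))
    (Wf : ∀ i, (Bf i).Cfg → (Tor (fine (L ^ (ι i).m * L ^ (ι i).k) (TGIndex.Mn d hL (ι i))) × Fin (d + 1) → ℝ) →ₗ[ℝ]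
      (Tor (fine (L ^ (ι i).m * L ^ (ι i).k) (TGIndex.Mn d hL (ι i))) × Fin (d + 1) → ℝ))
    (Wc : ∀ i, (Bc i).Cfg → (Tor (fine (L ^ (ι i).k) (TGIndex.Mn d hL (ι i))) × Fin (d + 1) → ℝ) →ₗ[ℝ] (Tor (fine (L ^ (ι i).k) (TGIndex.Mn d hL (ι i))) × Fin (d + 1) → ℝ))
    {θZ : ℝ} (hθL : (L : ℝ)⁻¹ ≤ θZ)
    (hW : ∃ βW mW βD ρ a₁ : ℝ, 0 < βW ∧ 0 < mW ∧ 0 < βD ∧ 0 < ρ ∧ 0 < a₁ ∧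
      ∀ (i : I) (α₀ : ℝ), 0 < α₀ → α₀ ≤ a₁ → ∀ U : (Bf i).Cfg, (Bf i).Reg335 c35 α₀ U →
        HasMaj (BlockNorm.ofBlocks (unitTorusGeo L (ι i).k (TGIndex.Mn d hL (ι i))) (blkFine L (ι i).k (TGIndex.Mn d hL (ι i))))
          (BlockNorm.ofBlocks (unitTorusGeo L (ι i).k (TGIndex.Mn d hL (ι i))) (blkFine L (ι i).k (TGIndex.Mn d hL (ι i)))) (Wc i ((pair i).avg U))
          (fun y y' => βW * α₀ * Real.exp (-(ρ * tdistT (TGIndex.Mn d hL (ι i)) y y'))) ∧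
        HasMaj (BlockNorm.ofBlocks (unitTorusGeo L (ι i).k (TGIndex.Mn d hL (ι i))) (fun x : Tor (fine (L ^ (ι i).m * L ^ (ι i).k) (TGIndex.Mn d hL (ι i))) × Fin (d + 1) =>
            blockOf (L ^ (ι i).m * L ^ (ι i).k) (TGIndex.Mn d hL (ι i)) x.1))
          (BlockNorm.ofBlocks (unitTorusGeo L (ι i).k (TGIndex.Mn d hL (ι i))) (fun x : Tor (fine (L ^ (ι i).m * L ^ (ι i).k) (TGIndex.Mn d hL (ι i))) × Fin (d + 1) =>
            blockOf (L ^ (ι i).m * L ^ (ι i).k) (TGIndex.Mn d hL (ι i)) x.1)) (Wf i U)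
          (fun y y' => βW * α₀ * Real.exp (-(ρ * tdistT (TGIndex.Mn d hL (ι i)) y y'))) ∧
        HasMaj (BlockNorm.ofBlocks (unitTorusGeo L (ι i).k (TGIndex.Mn d hL (ι i))) (blkFine L (ι i).k (TGIndex.Mn d hL (ι i))))
          (BlockNorm.ofBlocks (unitTorusGeo L (ι i).k (TGIndex.Mn d hL (ι i))) (fun x : Tor (fine (L ^ (ι i).m * L ^ (ι i).k) (TGIndex.Mn d hL (ι i))) × Fin (d + 1) =>
            blockOf (L ^ (ι i).m * L ^ (ι i).k) (TGIndex.Mn d hL (ι i)) x.1))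
          (idef (pull (kingPrV L (ι i).k (ι i).m (TGIndex.Mn d hL (ι i)))) (pull (kingPrV L (ι i).k (ι i).m (TGIndex.Mn d hL (ι i)))) (Wf i U) (Wc i ((pair i).avg U)))
          (fun y y' => mW * θZ ^ (ι i).k * Real.exp (-(ρ * tdistT (TGIndex.Mn d hL (ι i)) y y'))) ∧
        (∀ κ : Fin (d + 1), HasMaj (BlockNorm.ofBlocks (unitTorusGeo L (ι i).k (TGIndex.Mn d hL (ι i))) (blkFine L (ι i).k (TGIndex.Mn d hL (ι i))))
          (BlockNorm.ofBlocks (unitTorusGeo L (ι i).k (TGIndex.Mn d hL (ι i))) (blkFine L (ι i).k (TGIndex.Mn d hL (ι i))))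
          (symbOp (TGIndex.Mn d hL (ι i)) (L ^ (ι i).k) (sD (TGIndex.Mn d hL (ι i)) (L ^ (ι i).k) κ ((L ^ (ι i).k : ℕ) : ℝ)) ∘ₗ Wc i ((pair i).avg U))
          (fun y y' => βD * α₀ * Real.exp (-(ρ * tdistT (TGIndex.Mn d hL (ι i)) y y'))))) :
    ∃ δZ ζ τ a₁ : ℝ, 0 < δZ ∧ 0 < ζ ∧ 0 < τ ∧ 0 < a₁ ∧
      ∀ (i : I) (α₀ : ℝ), 0 < α₀ → α₀ ≤ a₁ → ∀ U : (Bf i).Cfg, (Bf i).Reg335 c35 α₀ U →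
        (∀ p q : B4.Idx (pbox (TGIndex.Mn d hL (ι i))) (d + 1),
            |unitBondMat (TGIndex.Mn d hL (ι i)) (qvRe _ (L ^ (ι i).k) ∘ₗ (Wc i ((pair i).avg U) ∘ₗ qvAdjRe _ (L ^ (ι i).k))) p q|
              ≤ ζ * α₀ * Real.exp (-(δZ * pdist (TGIndex.Mn d hL (ι i)) (one_le_M _) (p.1 : Fin (d + 1) → ℤ) (q.1 : Fin (d + 1) → ℤ)))) ∧
        (∀ p q : B4.Idx (pbox (TGIndex.Mn d hL (ι i))) (d + 1),
            |unitBondMat (TGIndex.Mn d hL (ι i)) (qvRe _ (L ^ (ι i).m * L ^ (ι i).k) ∘ₗ (Wf i U ∘ₗ qvAdjRe _ (L ^ (ι i).m * L ^ (ι i).k))) p q|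
              ≤ ζ * α₀ * Real.exp (-(δZ * pdist (TGIndex.Mn d hL (ι i)) (one_le_M _) (p.1 : Fin (d + 1) → ℤ) (q.1 : Fin (d + 1) → ℤ)))) ∧
        (∀ p q : B4.Idx (pbox (TGIndex.Mn d hL (ι i))) (d + 1),
            |unitBondMat (TGIndex.Mn d hL (ι i)) (qvRe _ (L ^ (ι i).m * L ^ (ι i).k) ∘ₗ (Wf i U ∘ₗ qvAdjRe _ (L ^ (ι i).m * L ^ (ι i).k))) p q
                - unitBondMat (TGIndex.Mn d hL (ι i)) (qvRe _ (L ^ (ι i).k) ∘ₗ (Wc i ((pair i).avg U) ∘ₗ qvAdjRe _ (L ^ (ι i).k))) p q|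
              ≤ τ * θZ ^ (ι i).k * Real.exp (-(δZ * pdist (TGIndex.Mn d hL (ι i)) (one_le_M _) (p.1 : Fin (d + 1) → ℤ) (q.1 : Fin (d + 1) → ℤ)))) := by
  have hL1 : 1 ≤ L := by omega
  have hLpos : (0 : ℝ) < L := by exact_mod_cast (lt_of_lt_of_le zero_lt_two hL2)
  have hθ0 : 0 < θZ := lt_of_lt_of_le (inv_pos.mpr hLpos) hθL
  obtain ⟨βW, mW, βD, ρ, a₁, hβW, hmW, hβD, hρ, ha₁, H⟩ := hW
  have hd0 : (0 : ℝ) ≤ d := Nat.cast_nonneg d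
  have hc4 := latticeConst_nonneg (d + 1) (by positivity : (0 : ℝ) ≤ ρ / 4)
  -- ζ: size letter constant at σ = ρ/4 (majorant rate ρ − ρ/4 ≥ ρ/2); τ: the difference constant at σ = ρ/4 (rate ρ/4·… we read at ρ/2 after the gradient step at σ = ρ/4)
  refine ⟨ρ / 4,
    1 * βW * (1 * Real.exp ρ) * latticeConst (d + 1) (ρ / 4) * Real.exp (ρ - ρ / 4) + 1,
    (1 * (βW * a₁) * (2 * Real.exp (ρ / 2) * 1) * latticeConst (d + 1) (ρ / 4) * Real.exp (ρ / 2 - ρ / 4)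
        + 1 * mW * (1 * Real.exp (ρ / 2)) * latticeConst (d + 1) (ρ / 4) * Real.exp (ρ / 2 - ρ / 4)
        + (1 * (βD * a₁) * (1 * Real.exp ρ) * latticeConst (d + 1) (ρ / 4)) * Real.exp (ρ / 2)) + 1,
    a₁, by positivity, by positivity, by positivity, ha₁, fun i α₀ hα₀ hα₁ U hreg => ?_⟩
  obtain ⟨hWc, hWf, hE, hD⟩ := H i α₀ hα₀ hα₁ U hreg
  have hβα : 0 ≤ βW * α₀ := by positivity
  -- (L1) ⇒ size letters at rate ρ − ρ/4, read at ρ/4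
  have hZc := hasMaj_qWq (L := L) (M := TGIndex.Mn d hL (ι i)) (ι i).k (n := L ^ (ι i).k) hβα (by positivity : (0:ℝ) < ρ / 4) (by linarith : ρ / 4 ≤ ρ) hWc
  have hZf := hasMaj_qWq (L := L) (M := TGIndex.Mn d hL (ι i)) (ι i).k (n := L ^ (ι i).m * L ^ (ι i).k) hβα (by positivity : (0:ℝ) < ρ / 4) (by linarith : ρ / 4 ≤ ρ) hWf
  -- (L3) ⇒ the gradient letter with the gain (L^k)⁻¹ ≤ θ_Z^k, at rate ρ − ρ/4 ≥ ρ/2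
  have hLk : (0 : ℝ) < ((L ^ (ι i).k : ℕ) : ℝ) := by positivity
  have htinv : (((L ^ (ι i).k : ℕ) : ℝ))⁻¹ ≤ θZ ^ (ι i).k := by
    rw [Nat.cast_pow, ← inv_pow]
    exact pow_le_pow_left₀ (inv_nonneg.mpr hLpos.le) hθL _
  have hDW : ∀ κ : Fin (d + 1), HasMaj (BlockNorm.ofBlocks (unitTorusGeo L (ι i).k (TGIndex.Mn d hL (ι i))) (fun bb : Tor (TGIndex.Mn d hL (ι i)) × Fin (d + 1) => bb.1))
      (BlockNorm.ofBlocks (unitTorusGeo L (ι i).k (TGIndex.Mn d hL (ι i))) (blkFine L (ι i).k (TGIndex.Mn d hL (ι i))))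
      ((((L ^ (ι i).k : ℕ) : ℝ)⁻¹ • symbOp (TGIndex.Mn d hL (ι i)) (L ^ (ι i).k) (sD (TGIndex.Mn d hL (ι i)) (L ^ (ι i).k) κ ((L ^ (ι i).k : ℕ) : ℝ))) ∘ₗ
        (Wc i ((pair i).avg U) ∘ₗ qvAdjRe _ (L ^ (ι i).k)))
      (fun y y' => θZ ^ (ι i).k * (1 * (βD * a₁) * (1 * Real.exp ρ) * latticeConst (d + 1) (ρ / 4)) * Real.exp (-(ρ / 2 * tdistT (TGIndex.Mn d hL (ι i)) y y'))) := by
    intro κ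
    have h := hasMaj_grad_qvAdj_of_grad (L := L) (M := TGIndex.Mn d hL (ι i)) (ι i).k (by positivity : 0 ≤ βD * α₀) (by positivity : (0:ℝ) < ρ / 4)
      (by linarith : ρ / 4 ≤ ρ) κ (hD κ)
    refine h.mono fun y y' => ?_
    have hdy := tdistT_nonneg (TGIndex.Mn d hL (ι i)) y y'
    have hexp : Real.exp (-((ρ - ρ / 4) * tdistT (TGIndex.Mn d hL (ι i)) y y')) ≤ Real.exp (-(ρ / 2 * tdistT (TGIndex.Mn d hL (ι i)) y y')) :=
      Real.exp_le_exp.mpr (by nlinarith)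
    have hamp : ((L ^ (ι i).k : ℕ) : ℝ)⁻¹ * (1 * (βD * α₀) * (1 * Real.exp ρ) * latticeConst (d + 1) (ρ / 4)) ≤
        θZ ^ (ι i).k * (1 * (βD * a₁) * (1 * Real.exp ρ) * latticeConst (d + 1) (ρ / 4)) :=
      mul_le_mul htinv (mul_le_mul_of_nonneg_right (mul_le_mul_of_nonneg_right (by rw [one_mul, one_mul]; exact mul_le_mul_of_nonneg_left hα₁ hβD.le)
        (by positivity)) hc4) (by positivity) (by positivity)
    exact mul_le_mul hamp hexp (Real.exp_nonneg _) (by positivity)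
  -- (L2) read at rate ρ/2
  have hE' : HasMaj (BlockNorm.ofBlocks (unitTorusGeo L (ι i).k (TGIndex.Mn d hL (ι i))) (blkFine L (ι i).k (TGIndex.Mn d hL (ι i))))
      (BlockNorm.ofBlocks (unitTorusGeo L (ι i).k (TGIndex.Mn d hL (ι i))) (fun x : Tor (fine (L ^ (ι i).m * L ^ (ι i).k) (TGIndex.Mn d hL (ι i))) × Fin (d + 1) =>
        blockOf (L ^ (ι i).m * L ^ (ι i).k) (TGIndex.Mn d hL (ι i)) x.1))
      (idef (pull (kingPrV L (ι i).k (ι i).m (TGIndex.Mn d hL (ι i)))) (pull (kingPrV L (ι i).k (ι i).m (TGIndex.Mn d hL (ι i)))) (Wf i U) (Wc i ((pair i).avg U)))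
      (fun y y' => mW * θZ ^ (ι i).k * Real.exp (-(ρ / 2 * tdistT (TGIndex.Mn d hL (ι i)) y y'))) :=
    hE.mono fun y y' => exp_decay_mono (by positivity) (by linarith) (tdistT_nonneg _ y y')
  have hWf' : HasMaj (BlockNorm.ofBlocks (unitTorusGeo L (ι i).k (TGIndex.Mn d hL (ι i))) (fun x : Tor (fine (L ^ (ι i).m * L ^ (ι i).k) (TGIndex.Mn d hL (ι i))) × Fin (d + 1) =>
        blockOf (L ^ (ι i).m * L ^ (ι i).k) (TGIndex.Mn d hL (ι i)) x.1))
      (BlockNorm.ofBlocks (unitTorusGeo L (ι i).k (TGIndex.Mn d hL (ι i))) (fun x : Tor (fine (L ^ (ι i).m * L ^ (ι i).k) (TGIndex.Mn d hL (ι i))) × Fin (d + 1) =>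
        blockOf (L ^ (ι i).m * L ^ (ι i).k) (TGIndex.Mn d hL (ι i)) x.1)) (Wf i U)
      (fun y y' => βW * a₁ * Real.exp (-(ρ / 2 * tdistT (TGIndex.Mn d hL (ι i)) y y'))) :=
    hWf.mono fun y y' => (exp_decay_mono hβα (by linarith : ρ / 2 ≤ ρ) (tdistT_nonneg _ y y')).trans
      (mul_le_mul_of_nonneg_right (mul_le_mul_of_nonneg_left hα₁ hβW.le) (Real.exp_nonneg _))
  have hsub := hasMaj_qWq_sub (L := L) (M := TGIndex.Mn d hL (ι i)) (ι i).k (ι i).m (by positivity : 0 ≤ βW * a₁) (by positivity : 0 ≤ mW * θZ ^ (ι i).k)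
    (by positivity : 0 ≤ θZ ^ (ι i).k * (1 * (βD * a₁) * (1 * Real.exp ρ) * latticeConst (d + 1) (ρ / 4))) (by positivity : (0:ℝ) < ρ / 4) (by linarith : 2 * (ρ / 4) ≤ ρ / 2)
    hWf' hE' hDW
  refine ⟨fun p q => ?_, fun p q => ?_, fun p q => ?_⟩
  · refine (abs_unitBondMat_le_of_hasMaj (TGIndex.Mn d hL (ι i)) (ι i).k (by positivity) hZc p q).trans ?_
    have hE0 := Real.exp_nonneg (-((ρ - ρ / 4) * pdist (TGIndex.Mn d hL (ι i)) (one_le_M _) (p.1 : Fin (d + 1) → ℤ) (q.1 : Fin (d + 1) → ℤ)))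
    calc 1 * (βW * α₀) * (1 * Real.exp ρ) * latticeConst (d + 1) (ρ / 4) * Real.exp (ρ - ρ / 4) *
          Real.exp (-((ρ - ρ / 4) * pdist (TGIndex.Mn d hL (ι i)) (one_le_M _) (p.1 : Fin (d + 1) → ℤ) (q.1 : Fin (d + 1) → ℤ)))
        = (1 * βW * (1 * Real.exp ρ) * latticeConst (d + 1) (ρ / 4) * Real.exp (ρ - ρ / 4)) * α₀ *
          Real.exp (-((ρ - ρ / 4) * pdist (TGIndex.Mn d hL (ι i)) (one_le_M _) (p.1 : Fin (d + 1) → ℤ) (q.1 : Fin (d + 1) → ℤ))) := by ring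
      _ ≤ (1 * βW * (1 * Real.exp ρ) * latticeConst (d + 1) (ρ / 4) * Real.exp (ρ - ρ / 4) + 1) * α₀ *
          Real.exp (-(ρ / 4 * pdist (TGIndex.Mn d hL (ι i)) (one_le_M _) (p.1 : Fin (d + 1) → ℤ) (q.1 : Fin (d + 1) → ℤ))) :=
          mul_le_mul (mul_le_mul_of_nonneg_right (by linarith) hα₀.le) (Real.exp_le_exp.mpr (by nlinarith [T4Cov2156Rate.bondDist_nonneg (one_le_M (TGIndex.Mn d hL (ι i))) p q]))
            hE0 (by positivity)
  · refine (abs_unitBondMat_le_of_hasMaj (TGIndex.Mn d hL (ι i)) (ι i).k (by positivity) hZf p q).trans ?_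
    have hE0 := Real.exp_nonneg (-((ρ - ρ / 4) * pdist (TGIndex.Mn d hL (ι i)) (one_le_M _) (p.1 : Fin (d + 1) → ℤ) (q.1 : Fin (d + 1) → ℤ)))
    calc 1 * (βW * α₀) * (1 * Real.exp ρ) * latticeConst (d + 1) (ρ / 4) * Real.exp (ρ - ρ / 4) *
          Real.exp (-((ρ - ρ / 4) * pdist (TGIndex.Mn d hL (ι i)) (one_le_M _) (p.1 : Fin (d + 1) → ℤ) (q.1 : Fin (d + 1) → ℤ)))
        = (1 * βW * (1 * Real.exp ρ) * latticeConst (d + 1) (ρ / 4) * Real.exp (ρ - ρ / 4)) * α₀ *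
          Real.exp (-((ρ - ρ / 4) * pdist (TGIndex.Mn d hL (ι i)) (one_le_M _) (p.1 : Fin (d + 1) → ℤ) (q.1 : Fin (d + 1) → ℤ))) := by ring
      _ ≤ (1 * βW * (1 * Real.exp ρ) * latticeConst (d + 1) (ρ / 4) * Real.exp (ρ - ρ / 4) + 1) * α₀ *
          Real.exp (-(ρ / 4 * pdist (TGIndex.Mn d hL (ι i)) (one_le_M _) (p.1 : Fin (d + 1) → ℤ) (q.1 : Fin (d + 1) → ℤ))) :=
          mul_le_mul (mul_le_mul_of_nonneg_right (by linarith) hα₀.le) (Real.exp_le_exp.mpr (by nlinarith [T4Cov2156Rate.bondDist_nonneg (one_le_M (TGIndex.Mn d hL (ι i))) p q]))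
            hE0 (by positivity)
  · rw [← Matrix.sub_apply, ← unitBondMat_sub]
    refine (abs_unitBondMat_le_of_hasMaj (TGIndex.Mn d hL (ι i)) (ι i).k (by positivity) hsub p q).trans ?_
    have hE0 := Real.exp_nonneg (-((ρ / 2 - ρ / 4) * pdist (TGIndex.Mn d hL (ι i)) (one_le_M _) (p.1 : Fin (d + 1) → ℤ) (q.1 : Fin (d + 1) → ℤ)))
    have ht0 : 0 ≤ θZ ^ (ι i).k := pow_nonneg hθ0.le _
    have hθk1 : θZ ^ (ι i).k ≤ θZ ^ (ι i).k := le_rfl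
    -- every summand carries a factor ≤ θ_Z^k: the first through (L^k)⁻¹ ≤ θ_Z^k (inside `2e^{ρ/2}/L^k`), the second and third explicitly
    have hLkθ : 2 * Real.exp (ρ / 2) / (L : ℝ) ^ (ι i).k * 1 ≤ 2 * Real.exp (ρ / 2) * θZ ^ (ι i).k := by
      rw [mul_one, div_eq_mul_inv]
      refine mul_le_mul_of_nonneg_left ?_ (by positivity)
      have : ((L : ℝ) ^ (ι i).k)⁻¹ = (((L ^ (ι i).k : ℕ) : ℝ))⁻¹ := by push_cast; ring
      rw [this]; exact htinv
    have hsum : 1 * (βW * a₁) * (2 * Real.exp (ρ / 2) / (L : ℝ) ^ (ι i).k * 1) * latticeConst (d + 1) (ρ / 4) * Real.exp (ρ / 2 - ρ / 4)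
          + 1 * (mW * θZ ^ (ι i).k) * (1 * Real.exp (ρ / 2)) * latticeConst (d + 1) (ρ / 4) * Real.exp (ρ / 2 - ρ / 4)
          + θZ ^ (ι i).k * (1 * (βD * a₁) * (1 * Real.exp ρ) * latticeConst (d + 1) (ρ / 4)) * Real.exp (ρ / 2)
        ≤ ((1 * (βW * a₁) * (2 * Real.exp (ρ / 2) * 1) * latticeConst (d + 1) (ρ / 4) * Real.exp (ρ / 2 - ρ / 4)
            + 1 * mW * (1 * Real.exp (ρ / 2)) * latticeConst (d + 1) (ρ / 4) * Real.exp (ρ / 2 - ρ / 4)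
            + (1 * (βD * a₁) * (1 * Real.exp ρ) * latticeConst (d + 1) (ρ / 4)) * Real.exp (ρ / 2)) + 1) * θZ ^ (ι i).k := by
      have h1 : 1 * (βW * a₁) * (2 * Real.exp (ρ / 2) / (L : ℝ) ^ (ι i).k * 1) * latticeConst (d + 1) (ρ / 4) * Real.exp (ρ / 2 - ρ / 4)
          ≤ 1 * (βW * a₁) * (2 * Real.exp (ρ / 2) * θZ ^ (ι i).k) * latticeConst (d + 1) (ρ / 4) * Real.exp (ρ / 2 - ρ / 4) :=
        mul_le_mul_of_nonneg_right (mul_le_mul_of_nonneg_right (mul_le_mul_of_nonneg_left hLkθ (by positivity)) hc4) (Real.exp_nonneg _)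
      nlinarith [h1, ht0, mul_nonneg (mul_nonneg (mul_nonneg hβW.le ha₁.le) hc4) (Real.exp_nonneg (ρ / 2 - ρ / 4)),
        mul_nonneg (mul_nonneg hmW.le hc4) (Real.exp_nonneg (ρ / 2 - ρ / 4)), mul_nonneg (mul_nonneg (mul_nonneg hβD.le ha₁.le) hc4) (Real.exp_nonneg ρ),
        Real.exp_nonneg (ρ / 2)]
    exact mul_le_mul hsum (Real.exp_le_exp.mpr (by nlinarith [T4Cov2156Rate.bondDist_nonneg (one_le_M (TGIndex.Mn d hL (ι i))) p q])) hE0 (by positivity)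

end Family

/-! ## §3 ★★★ The knit from increment letters: V-F's socket ∘ §2 -/

section Knit
variable {I : Type} (ι : I → TGIndex) (gf : I → B9.Geometry) (Bc Bf : I → B9.Backgrounds)
/-- ★★★ **`NE2PlusUnit` WITH THE EXACTLY DRESSED U-SEEING UNIT LAYER FROM THE THREE INCREMENT LETTERS ALONE** (V-F `ne2PlusUnit_tgCovExOn_of_letters` ∘ §2; `d ≥ 1`, `L ≥ 2`, `b > 0`,
indices `m_T ≥ 1`, guard scales `≥ 1`, rate `L⁻¹ ≤ θ_Z < 1`). [cite: Balaban1985BackgroundPropagators, Thm 3.15 (3.185)–(3.187) p.432 (quantifier template); Balaban1984PropagatorsI, (1.102)–(1.103) p.34 (the dressing map)] -/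
theorem ne2PlusUnit_tgCovExOn_of_incrementLetters (hd : 1 ≤ d) (hL2 : 2 ≤ L) (hL : Odd L ∧ 1 < L) {b : ℝ} (hb : 0 < b) (c35 : ℝ) (α β : Fin (d + 1))
    (hι : ∀ i, 1 ≤ (ι i).mT) (hM : ∀ i, 1 ≤ (gf i).M) (pair : ∀ i, EtaPairing (tgGeoC d hL (ι i)) (gf i) (Bc i) (Bf i))
    (Wf : ∀ i, (Bf i).Cfg → (Tor (fine (L ^ (ι i).m * L ^ (ι i).k) (TGIndex.Mn d hL (ι i))) × Fin (d + 1) → ℝ) →ₗ[ℝ]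
      (Tor (fine (L ^ (ι i).m * L ^ (ι i).k) (TGIndex.Mn d hL (ι i))) × Fin (d + 1) → ℝ))
    (Wc : ∀ i, (Bc i).Cfg → (Tor (fine (L ^ (ι i).k) (TGIndex.Mn d hL (ι i))) × Fin (d + 1) → ℝ) →ₗ[ℝ] (Tor (fine (L ^ (ι i).k) (TGIndex.Mn d hL (ι i))) × Fin (d + 1) → ℝ))
    {θZ : ℝ} (hθL : (L : ℝ)⁻¹ ≤ θZ) (hθ1 : θZ < 1)
    (hW : ∃ βW mW βD ρ a₁ : ℝ, 0 < βW ∧ 0 < mW ∧ 0 < βD ∧ 0 < ρ ∧ 0 < a₁ ∧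
      ∀ (i : I) (α₀ : ℝ), 0 < α₀ → α₀ ≤ a₁ → ∀ U : (Bf i).Cfg, (Bf i).Reg335 c35 α₀ U →
        HasMaj (BlockNorm.ofBlocks (unitTorusGeo L (ι i).k (TGIndex.Mn d hL (ι i))) (blkFine L (ι i).k (TGIndex.Mn d hL (ι i))))
          (BlockNorm.ofBlocks (unitTorusGeo L (ι i).k (TGIndex.Mn d hL (ι i))) (blkFine L (ι i).k (TGIndex.Mn d hL (ι i)))) (Wc i ((pair i).avg U))
          (fun y y' => βW * α₀ * Real.exp (-(ρ * tdistT (TGIndex.Mn d hL (ι i)) y y'))) ∧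
        HasMaj (BlockNorm.ofBlocks (unitTorusGeo L (ι i).k (TGIndex.Mn d hL (ι i))) (fun x : Tor (fine (L ^ (ι i).m * L ^ (ι i).k) (TGIndex.Mn d hL (ι i))) × Fin (d + 1) =>
            blockOf (L ^ (ι i).m * L ^ (ι i).k) (TGIndex.Mn d hL (ι i)) x.1))
          (BlockNorm.ofBlocks (unitTorusGeo L (ι i).k (TGIndex.Mn d hL (ι i))) (fun x : Tor (fine (L ^ (ι i).m * L ^ (ι i).k) (TGIndex.Mn d hL (ι i))) × Fin (d + 1) =>
            blockOf (L ^ (ι i).m * L ^ (ι i).k) (TGIndex.Mn d hL (ι i)) x.1)) (Wf i U)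
          (fun y y' => βW * α₀ * Real.exp (-(ρ * tdistT (TGIndex.Mn d hL (ι i)) y y'))) ∧
        HasMaj (BlockNorm.ofBlocks (unitTorusGeo L (ι i).k (TGIndex.Mn d hL (ι i))) (blkFine L (ι i).k (TGIndex.Mn d hL (ι i))))
          (BlockNorm.ofBlocks (unitTorusGeo L (ι i).k (TGIndex.Mn d hL (ι i))) (fun x : Tor (fine (L ^ (ι i).m * L ^ (ι i).k) (TGIndex.Mn d hL (ι i))) × Fin (d + 1) =>
            blockOf (L ^ (ι i).m * L ^ (ι i).k) (TGIndex.Mn d hL (ι i)) x.1))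
          (idef (pull (kingPrV L (ι i).k (ι i).m (TGIndex.Mn d hL (ι i)))) (pull (kingPrV L (ι i).k (ι i).m (TGIndex.Mn d hL (ι i)))) (Wf i U) (Wc i ((pair i).avg U)))
          (fun y y' => mW * θZ ^ (ι i).k * Real.exp (-(ρ * tdistT (TGIndex.Mn d hL (ι i)) y y'))) ∧
        (∀ κ : Fin (d + 1), HasMaj (BlockNorm.ofBlocks (unitTorusGeo L (ι i).k (TGIndex.Mn d hL (ι i))) (blkFine L (ι i).k (TGIndex.Mn d hL (ι i))))
          (BlockNorm.ofBlocks (unitTorusGeo L (ι i).k (TGIndex.Mn d hL (ι i))) (blkFine L (ι i).k (TGIndex.Mn d hL (ι i))))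
          (symbOp (TGIndex.Mn d hL (ι i)) (L ^ (ι i).k) (sD (TGIndex.Mn d hL (ι i)) (L ^ (ι i).k) κ ((L ^ (ι i).k : ℕ) : ℝ)) ∘ₗ Wc i ((pair i).avg U))
          (fun y y' => βD * α₀ * Real.exp (-(ρ * tdistT (TGIndex.Mn d hL (ι i)) y y'))))) :
    NE2PlusUnit c35 (fun i => (⟨tgGeoC d hL (ι i), gf i, Bc i, Bf i, pair i⟩ : PairedInstance))
      (tgCovExOn ι gf Bc Bf d hL b α β pair
        (fun i U => unitBondMat (TGIndex.Mn d hL (ι i)) (qvRe _ (L ^ (ι i).m * L ^ (ι i).k) ∘ₗ (Wf i U ∘ₗ qvAdjRe _ (L ^ (ι i).m * L ^ (ι i).k))))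
        (fun i V => unitBondMat (TGIndex.Mn d hL (ι i)) (qvRe _ (L ^ (ι i).k) ∘ₗ (Wc i V ∘ₗ qvAdjRe _ (L ^ (ι i).k)))))
      (fun _ _ => True) (fun i => (tgGeoC d hL (ι i)).dist) :=
  ne2PlusUnit_tgCovExOn_of_letters (d := d) ι gf Bc Bf hd hL2 hL hb c35 α β hι hM pair _ _ hθL hθ1
    (zLetters_of_incrementLetters (d := d) ι gf Bc Bf hL2 hL c35 pair Wf Wc hθL hW)
/-- ★★★ **`N15At` FROM AN OPERATOR LAYER BY NAME AND THE THREE INCREMENT LETTERS** (V-F `n15At_tgEx_of_ne2PlusOperator` ∘ §2): the producer's `NE2PlusOperator` plus the en-route letters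
of its increment `W = E − G` give ALL THREE NE2 conjuncts, the unit layer READING `U` through Bałaban's `(Q E Q*)⁻¹ − b`; SITE = G1's `U ≡ 1` kernel (U-blind — said). [bookkeeping] -/
theorem n15At_tgEx_of_incrementLetters (hd : 1 ≤ d) (hLodd : Odd L) (hL2 : 2 ≤ L) (hL : Odd L ∧ 1 < L) {b aS : ℝ} (hb : 0 < b) (haS : 0 < aS) (α β : Fin (d + 1))
    (hι : ∀ i, 1 ≤ (ι i).mT) (hM : ∀ i, 1 ≤ (gf i).M) (pair : ∀ i, EtaPairing (tgGeoC d hL (ι i)) (gf i) (Bc i) (Bf i)) {c35 : ℝ} (p : ℝ)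
    (Kop : ∀ i, B9.KernelFamily (tgGeoC d hL (ι i)) (Bf i))
    (hop : NE2PlusOperator c35 (fun i => (⟨tgGeoC d hL (ι i), gf i, Bc i, Bf i, pair i⟩ : PairedInstance)) Kop)
    (Wf : ∀ i, (Bf i).Cfg → (Tor (fine (L ^ (ι i).m * L ^ (ι i).k) (TGIndex.Mn d hL (ι i))) × Fin (d + 1) → ℝ) →ₗ[ℝ]
      (Tor (fine (L ^ (ι i).m * L ^ (ι i).k) (TGIndex.Mn d hL (ι i))) × Fin (d + 1) → ℝ))
    (Wc : ∀ i, (Bc i).Cfg → (Tor (fine (L ^ (ι i).k) (TGIndex.Mn d hL (ι i))) × Fin (d + 1) → ℝ) →ₗ[ℝ] (Tor (fine (L ^ (ι i).k) (TGIndex.Mn d hL (ι i))) × Fin (d + 1) → ℝ))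
    {θZ : ℝ} (hθL : (L : ℝ)⁻¹ ≤ θZ) (hθ1 : θZ < 1)
    (hW : ∃ βW mW βD ρ a₁ : ℝ, 0 < βW ∧ 0 < mW ∧ 0 < βD ∧ 0 < ρ ∧ 0 < a₁ ∧
      ∀ (i : I) (α₀ : ℝ), 0 < α₀ → α₀ ≤ a₁ → ∀ U : (Bf i).Cfg, (Bf i).Reg335 c35 α₀ U →
        HasMaj (BlockNorm.ofBlocks (unitTorusGeo L (ι i).k (TGIndex.Mn d hL (ι i))) (blkFine L (ι i).k (TGIndex.Mn d hL (ι i))))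
          (BlockNorm.ofBlocks (unitTorusGeo L (ι i).k (TGIndex.Mn d hL (ι i))) (blkFine L (ι i).k (TGIndex.Mn d hL (ι i)))) (Wc i ((pair i).avg U))
          (fun y y' => βW * α₀ * Real.exp (-(ρ * tdistT (TGIndex.Mn d hL (ι i)) y y'))) ∧
        HasMaj (BlockNorm.ofBlocks (unitTorusGeo L (ι i).k (TGIndex.Mn d hL (ι i))) (fun x : Tor (fine (L ^ (ι i).m * L ^ (ι i).k) (TGIndex.Mn d hL (ι i))) × Fin (d + 1) =>
            blockOf (L ^ (ι i).m * L ^ (ι i).k) (TGIndex.Mn d hL (ι i)) x.1))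
          (BlockNorm.ofBlocks (unitTorusGeo L (ι i).k (TGIndex.Mn d hL (ι i))) (fun x : Tor (fine (L ^ (ι i).m * L ^ (ι i).k) (TGIndex.Mn d hL (ι i))) × Fin (d + 1) =>
            blockOf (L ^ (ι i).m * L ^ (ι i).k) (TGIndex.Mn d hL (ι i)) x.1)) (Wf i U)
          (fun y y' => βW * α₀ * Real.exp (-(ρ * tdistT (TGIndex.Mn d hL (ι i)) y y'))) ∧
        HasMaj (BlockNorm.ofBlocks (unitTorusGeo L (ι i).k (TGIndex.Mn d hL (ι i))) (blkFine L (ι i).k (TGIndex.Mn d hL (ι i))))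
          (BlockNorm.ofBlocks (unitTorusGeo L (ι i).k (TGIndex.Mn d hL (ι i))) (fun x : Tor (fine (L ^ (ι i).m * L ^ (ι i).k) (TGIndex.Mn d hL (ι i))) × Fin (d + 1) =>
            blockOf (L ^ (ι i).m * L ^ (ι i).k) (TGIndex.Mn d hL (ι i)) x.1))
          (idef (pull (kingPrV L (ι i).k (ι i).m (TGIndex.Mn d hL (ι i)))) (pull (kingPrV L (ι i).k (ι i).m (TGIndex.Mn d hL (ι i)))) (Wf i U) (Wc i ((pair i).avg U)))
          (fun y y' => mW * θZ ^ (ι i).k * Real.exp (-(ρ * tdistT (TGIndex.Mn d hL (ι i)) y y'))) ∧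
        (∀ κ : Fin (d + 1), HasMaj (BlockNorm.ofBlocks (unitTorusGeo L (ι i).k (TGIndex.Mn d hL (ι i))) (blkFine L (ι i).k (TGIndex.Mn d hL (ι i))))
          (BlockNorm.ofBlocks (unitTorusGeo L (ι i).k (TGIndex.Mn d hL (ι i))) (blkFine L (ι i).k (TGIndex.Mn d hL (ι i))))
          (symbOp (TGIndex.Mn d hL (ι i)) (L ^ (ι i).k) (sD (TGIndex.Mn d hL (ι i)) (L ^ (ι i).k) κ ((L ^ (ι i).k : ℕ) : ℝ)) ∘ₗ Wc i ((pair i).avg U))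
          (fun y y' => βD * α₀ * Real.exp (-(ρ * tdistT (TGIndex.Mn d hL (ι i)) y y'))))) :
    N15At { I := I, c35 := c35, p := p, pi := fun i => ⟨tgGeoC d hL (ι i), gf i, Bc i, Bf i, pair i⟩, Kop := Kop, Ksite := tgSiteOn d hL aS ι Bf,
            Kunit := tgCovExOn ι gf Bc Bf d hL b α β pair
              (fun i U => unitBondMat (TGIndex.Mn d hL (ι i)) (qvRe _ (L ^ (ι i).m * L ^ (ι i).k) ∘ₗ (Wf i U ∘ₗ qvAdjRe _ (L ^ (ι i).m * L ^ (ι i).k))))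
              (fun i V => unitBondMat (TGIndex.Mn d hL (ι i)) (qvRe _ (L ^ (ι i).k) ∘ₗ (Wc i V ∘ₗ qvAdjRe _ (L ^ (ι i).k)))),
            inΛ := fun _ _ => True, unitDist := fun i => (tgGeoC d hL (ι i)).dist } :=
  n15At_tgEx_of_ne2PlusOperator (d := d) ι gf Bc Bf hd hLodd hL2 hL hb haS α β hι hM pair p Kop hop _ _ hθL hθ1
    (zLetters_of_incrementLetters (d := d) ι gf Bc Bf hL2 hL c35 pair Wf Wc hθL hW)

end Knit

end Summit.QuantumFields.YangMills.BalabanUVNodes.N15.UnitLayerBg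

end
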